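/-
Origin: expansion seat `planner-pub-hodgecm-mc-axioms-1-g14-0`, handover #W183 2026-08-20T15:53:55Z md5 0434d88ae73d (PKG 13aadf7cc2d2 → 0434d88ae73d; 133 l.; MECHANICAL (iib-R) rewrite v3.1 of the PKG file as it stands (24 token edits; rules R1x1+RX[h₂']x23)) (`HOME/mc/pub-hodgecm-mc-axioms-1-g14/revendor/kit-r55/stage55/HodgeCM/Model/Sanity/DegenerateClosureR20AE.lean`, md5 0434d88ae73d, 133 lines);
landed by the gen-22 packager (p-g22) in gate run 55 REPLACES the earlier landed copy of `HodgeCM/Model/Sanity/DegenerateClosureR20AE.lean` (seat copy carried the packager Origin header of an earlier run (stripped)).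
-/
/-
Origin: SANITY lane `planner-pub-hodgecm-mc-sanity-1-g11-0` (unit pub-hodgecm-mc-sanity-1-g11, gen 11 of mc-sanity-1,
node SAN-23), 2026-08-20.  NEW additive KERNEL leaf `HodgeCM/Model/Sanity/DegenerateClosureR20AE.lean` over the
RUN-40 row `HodgeCM.Model.E2InstanceR20AE` (glue-1 #367: E revision 20AE = R19AE with row 11 `hk` RE-TYPED to the
ALONG form `IsPMinusKilledAlong expP (-I • e_p)` for both `p : Fin 2`, 15 binders, same conclusion) and the installed
RUN-38 leaf `HodgeCM.Model.Sanity.DegenerateClosureR19AE` (SAN-21: the degenerate closure of R19AE; brings SAN-20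
`hsmall_degS`, SAN-15 `CdegS` / `NoGoodSextic`, SAN-10b, SAN-11, SAN-12, SAN-17a).  Imported by nothing.
CONDITIONAL ROW: tabled only together with #367; INSTALL AFTER #367 and after SAN-21 (installed).
KERNEL: 0 records, 0 `Prop` definitions, 0 `def`s, 0 hypotheses minted, nothing cited, no instances.
Expected `#print axioms`: ⊆ {propext, Classical.choice, Quot.sound}.
-/
import Summits.HodgeConjecture.HodgeCM.Model.E2InstanceR20AE
import Summits.HodgeConjecture.HodgeCM.Model.Sanity.DegenerateClosureR19AE

/-!
# SAN-23 — the DEGENERATE CLOSURE of E R20AE (row 11 `hk` in the ALONG form)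

MODEL-CONSTRUCTION sub-cell, SANITY lane (unit `pub-hodgecm-mc-sanity-1-g11`, node SAN-23).  KERNEL only; census leaf.

SAN-21 (`Sanity/DegenerateClosureR19AE`) closed the E term of record `Model.perL_picardCM_r19AE` over the degenerate
inhabitants `S := degS`, `W := zeroSK ∘ W` modulo the single DATA binder `CdegS` (empty: SAN-15b).  Revision 20AE
(RUN 40, glue-1 #367 `Model.perL_picardCM_r20AE`) has the SAME 15 binder groups `h hA W S μ hR hsmall C hT hpd hk gen12
real34 hyp12 hyp34` and the same conclusion; the one change is row 11 `hk`, whose tail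
`(C V c hV hc h6 k hk N hN).IsPMinusKilled expP` becomes
`∀ p : Fin 2, (C V c hV hc h6 k hk N hN).IsPMinusKilledAlong expP (-Complex.I • Pi.single p 1)`
(WEAKER as a hypothesis, `isPMinusKilled_iff`; the `hol` slot of `perL_picardCM_r13core` is then assembled in kernel
by theta-3's `ArchKTypeData.hol_of_isPMinusKilledAlong`).  This file records the degenerate census of that revision:

* `perL_r20AE_degS` — E R20AE at `S := degS`, `W := zeroSK ∘ W` closes `(picardCMUniverse …).PerL` from `h hA W μ hR`
  and the ONE binder `CdegS`; the eight Prop-row discharges are VERBATIM those of SAN-21 `perL_r19AE_degS` (`hsmall`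
  by SAN-20 `hsmall_degS`, `hT` SAN-17a, `hpd` / `hk` by the empty fibre of `C` over `degS` (SAN-10b) — the re-typed
  `hk` has one more binder `p : Fin 2` in front of the SAME empty fibre, so it is exactly as vacuous as before —,
  `gen12` / `real34` / `hyp12` / `hyp34` SAN-12).
* `perL_r20AE_degS_eq` — over the degenerate data the R20AE closure and SAN-21's R19AE closure are the same
  proposition proved twice (proof irrelevance made explicit: the two census routes agree).
* `perL_r20AE_of_noGoodSextic` — so R20AE, like R10 / R13 / R15A / R17A / R18A / R19AE, closes from toys EXACTLY
  modulo the vacuity residual `NoGoodSextic` (refuted in kernel: SAN-15b `not_noGoodSextic`).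

READING (census, MODEL-N ±0; nothing here is a defect claim): re-typing `hk` to the along form changes an HONEST row
only at honest pins (where the `C`-fibre is inhabited and the two directions `-I • e_0`, `-I • e_1` are genuine
conditions on the arch K-type datum); over degenerate data the `C`-fibre is empty, so the degenerate census of E is
unchanged — every binder of E R20AE except `C` is free and `C` is the gatekeeper; toy-visible binders 15 → 15.
-/

set_option autoImplicit false

noncomputable section

namespace HodgeCM
namespace Model
namespace Sanity

open HodgeCM.Universe (SideData ThetaModel AdelicThetaCore AdelicTorusCore)
open HodgeCM.PerL34 HodgeCM.PerL34.ArchC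
open Literature.AlgebraicGeometry.HodgeTheory Literature.NumberTheory.Automorphic.PicardCM
open Literature.NumberTheory.Transcendental (Arapura2012_Cor_15_4_6)
open Literature.AlgebraicGeometry.ShimuraVarieties
open HodgeCM.Model.ThetaSpace
open HodgeCM.Model.SupplyResidual

variable (hHD : exists_isReal_hodgeModel) (hI : hodgePQ_independent_of_hodgeModel)
  (h₁ : BallQuotientUniformised)

/-- **E R20AE over the degenerate data closes PerL modulo the single binder `C`** — every Prop-row discharge
VERBATIM as in SAN-21 `perL_r19AE_degS`; the along-form row 11 `hk` is vacuous over the empty `C`-fibre for each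
`p : Fin 2`. -/
theorem perL_r20AE_degS (h₃' : CMAbelianVarietyEigenbasisRealised) (h : Bool)
    (hA : Arapura2012_Cor_15_4_6)
    (W : ∀ {L : CMField} {ι₁ : L →+* ℂ} (V : HermSpace3 L ι₁) (c : SeesawCtx L), WmInput V c.D)
    (μ : ∀ {L : CMField}, SeesawCtx L → Fin 4 → NumberField.InfinitePlace L → ℤ)
    (hR : DeligneMilne1982_Thm_6_20_full)
    (C : CdegS hHD hI h₁ (cmAbelianVarietyRealised_of_eigenbasis hHD hI h₃') h hA W μ) :
    (picardCMUniverse hHD hI h₁ (cmAbelianVarietyRealised_of_eigenbasis hHD hI h₃')).PerL := by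
  refine perL_picardCM_r20AE hHD hI h₁ h₃' h hA (fun V c => (W V c).zeroSK) degS μ hR
    ?_ C ?_ ?_ ?_ ?_ ?_ ?_ ?_
  · -- `hsmall`
    intro L ι₁ V c hc hK i
    exact hsmall_degS hHD hI h₁ _ h (embOf hHD hI h₁ _) (coverOf hHD hI h₁ _ hA)
      (wmOfInput fun V c => (W V c).zeroSK) (d12Of μ) (d34Of μ) V c hc hK i
  · -- `hT`
    intro L ι₁ V c k N
    exact isThetaArchContinuous_degS V c k N
  · -- `hpd`
    intro L ι₁ V c hV hc h6 k hk N hN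
    exact ((isEmpty_C_fibre_degS hHD hI h₁ _ V c hV).false (C V c hV hc h6)).elim
  · -- `hk` (along form: one more binder `p : Fin 2`, same empty fibre)
    intro L ι₁ V c hV hc h6 k hk N hN p
    exact ((isEmpty_C_fibre_degS hHD hI h₁ _ V c hV).false (C V c hV hc h6)).elim
  · -- `gen12`
    intro L ι₁ V c
    exact gen12_degS' hHD hI h₁ _ h (embOf hHD hI h₁ _) (coverOf hHD hI h₁ _ hA)
      (fun V c => (W V c).zeroSK) μ V c
  · -- `real34`
    intro L ι₁ V c _ _
    exact real34_zeroSK (embOf hHD hI h₁ _) (coverOf hHD hI h₁ _ hA) W _ h (d12Of μ) (d34Of μ) V c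
  · -- `hyp12`
    intro L ι₁ V c _ _
    exact hyp12_zeroSK (embOf hHD hI h₁ _) (coverOf hHD hI h₁ _ hA) W _ h _ _ _ V c
  · -- `hyp34`
    intro L ι₁ V c _ _
    exact hyp34_zeroSK (embOf hHD hI h₁ _) (coverOf hHD hI h₁ _ hA) W _ h _ _ _ V c

/-- The R20AE closure and SAN-21's R19AE closure over the degenerate data are ONE proposition, proved along the two
revisions (proof irrelevance; recorded so that the census of record reads the same from either E term). -/
theorem perL_r20AE_degS_eq (h₃' : CMAbelianVarietyEigenbasisRealised) (h : Bool)
    (hA : Arapura2012_Cor_15_4_6)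
    (W : ∀ {L : CMField} {ι₁ : L →+* ℂ} (V : HermSpace3 L ι₁) (c : SeesawCtx L), WmInput V c.D)
    (μ : ∀ {L : CMField}, SeesawCtx L → Fin 4 → NumberField.InfinitePlace L → ℤ)
    (hR : DeligneMilne1982_Thm_6_20_full)
    (C : CdegS hHD hI h₁ (cmAbelianVarietyRealised_of_eigenbasis hHD hI h₃') h hA W μ) :
    perL_r20AE_degS hHD hI h₁ h₃' h hA W μ hR C = perL_r19AE_degS hHD hI h₁ h₃' h hA W μ hR C :=
  rfl

/-- **E R20AE closes from the degenerate data EXACTLY modulo the vacuity residual `NoGoodSextic`** (cf. SAN-21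
`perL_r19AE_of_noGoodSextic`; the residual is refuted by SAN-15b `not_noGoodSextic`). -/
theorem perL_r20AE_of_noGoodSextic (h₃' : CMAbelianVarietyEigenbasisRealised) (h : Bool)
    (hA : Arapura2012_Cor_15_4_6)
    (W : ∀ {L : CMField} {ι₁ : L →+* ℂ} (V : HermSpace3 L ι₁) (c : SeesawCtx L), WmInput V c.D)
    (μ : ∀ {L : CMField}, SeesawCtx L → Fin 4 → NumberField.InfinitePlace L → ℤ)
    (hR : DeligneMilne1982_Thm_6_20_full)
    (hno : NoGoodSextic hHD hI h₁ (cmAbelianVarietyRealised_of_eigenbasis hHD hI h₃') h hA W μ) :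
    (picardCMUniverse hHD hI h₁ (cmAbelianVarietyRealised_of_eigenbasis hHD hI h₃')).PerL :=
  perL_r20AE_degS hHD hI h₁ h₃' h hA W μ hR fun V c hV hc h6 => (hno V c hV hc h6).elim

end Sanity
end Model
end HodgeCM

end
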